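import Mathlib
import Literature.Probability.LatticeModels.PolymerPressure
import Literature.MathematicalPhysics.QuantumFieldTheory.Balaban1983to89.T4ActivityLipschitz
import Literature.MathematicalPhysics.QuantumFieldTheory.Balaban1983to89.T4DilationKP

/-!
# T4DilationKPLog — the LOGARITHMIC layer of the expansion branch of the NOT-PRINTED dilation hypothesis [H-dil-N]
(node U3, estimate NE9): holomorphy of the Kotecký–Preiss logarithm, of the truncated functionals and of the cluster sum
through a piece in a COMPLEX COUPLING, with VOLUME-UNIFORM ADDITIVE bounds on a set containing the dilation discs

If the activities `w γ z` of an abstract polymer gas are holomorphic in the coupling `z` on a set `U` containing the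
dilation discs `|z − s| ≤ c·s`, `s ≥ t₀`, and the Kotecký–Preiss condition holds UNIFORMLY IN `z ∈ U`
(`T4DilationKP.IsKPOn`), then the cluster sum through a piece `D ⊆ Λ`,
`W_D(z) = Σ_{C ⊆ Λ, C ∩ D ≠ ∅} Φ^T(C; w(·,z)) = log Z(Λ; z) − log Z(Λ ∖ D; z) = −log ρ_D(z)` (`pieceLog`; `ρ_D` the reduced
activity of `T4DilationKP`), is holomorphic on `U` with `‖W_D(z)‖ ≤ Σ_{γ ∈ D} a γ` in EVERY volume `Λ`, hence Lipschitz in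
the real coupling with constant `4(Σ_D a)/(c t₀)`; and the far pieces (clusters through `γ` of `d`-size `≥ r`) obey
`a(γ)·e^{−r}` under the `d`-weighted condition, by the tree's FINITE-VOLUME Kotecký–Preiss estimate (4).  This is the
`hlast` shape of `T4CouplingAnalyticity.stepTransferV_of_analyticOn` for the LOGARITHMIC object — the kind of object an
effective action is — with an ADDITIVE volume-uniform constant (the ratio `ρ_D` of `T4DilationKP` carries the multiplicative
`e^{Σ_D a}`): the clause «holomorphy IN z of the KP LOGARITHM / truncated functionals is not typed» of `T4DilationKP`'s
header, now typed.  (Cell `pub-balaban`, T4-DAG §2 node U3 / §6 NE9; journal row T4-U3.E-NE9-PROVE-P1k*; MODEL statements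
about abstract polymer gases with explicit constants, NO estimate of the cell's NEW-ESTIMATE kind for Bałaban's expansions,
NOT summit progress.)

HONEST FRAMING (T4-DAG PAGE 1).  The cell's T4 target is rung (B)+1: existence AND uniqueness of the ε → 0 limit of
Bałaban's unit-scale averaged expectations on a FIXED finite torus — strictly beyond ultraviolet stability
([Balaban1988Convergent] Cor. 3 p. 264; [Balaban1989LargeFieldII] Thm 1 p. 355), and NOT infinite volume, NOT a mass gap,
NOT the Clay problem; the hypotheses BetaPertH, (B), (B^μ) of the cell's chain stay explicit and are untouched here (this
module uses none of them).  NE9 is NOT PRINTED (cell NEW ESTIMATE).  This module ASSERTS NOTHING about Bałaban's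
functionals or expansions: every declaration is [folklore] — finite sums, principal logarithms, one-variable calculus and
elementary inequalities — over the ABSTRACT polymer gas of [KoteckyPreiss1986] as formalised and KERNEL-PROVED in the tree
(`Literature.Probability.LatticeModels.*`, a PUBLISHED result outside the audited series, used BY NAME), and over the
objects of `T4DilationKP`.  The manuscripts under audit are named for STRUCTURE only (ABSOLUTE RULE: no internally-minted
statement enters as a cited fact).

WHAT THIS LEAF ADDS AND WHY.  `T4DilationKP` (this lineage, generation 10) typed the expansion branch of [H-dil-N] on the
MULTIPLICATIVE object `ρ_D = Z(Λ∖D)/Z(Λ)` and left the logarithm only NAMED pointwise (`pieceRatio_eq_exp`).  The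
consumer of `hlast` feeds NE9-moduli that are SUMMED along a coupling history (`T4OutputRate.FadingMemory`,
`historySum_le_of_fadingMemory`), and an effective action is a SUM of localised terms: the natural currency is the
LOGARITHMIC one, with constants additive over pieces.  THIS LEAF supplies it: (§1) at the level of activity vectors
`w : P → ℂ` — the DELETION IDENTITY for the Kotecký–Preiss logarithm with the PRINCIPAL logarithm of the one-step ratio,
`log Z(Λ') = log Z(Λ'∖γ) + Log (Z(Λ')/Z(Λ'∖γ))` in a KP volume (`polymerLogZ_eq_erase_add_log`: along the ray `s•w` both
sides have the same derivative — `Z′/Z` of each volume by the FTC, the chain rule for `Log` on the slit plane, where the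
ratio stays since `‖Z(Λ')/Z(Λ'∖γ) − 1‖ ≤ x e^{−x} ≤ 1/2`, `x = |w γ|e^{a γ}` — and both vanish at `s = 0`), the one-term
cost `‖Log (ratio)‖ ≤ |w γ| e^{a γ}` (`norm_log_div_erase_le`, via the elementary `norm_log_one_add_le_of_le`), hence
`‖log Z(Λ') − log Z(Λ'∖D)‖ ≤ Σ_{γ∈D} |w γ|e^{a γ}` (`norm_polymerLogZ_sub_sdiff_le`; this is the special case
`wB = w·1_{∉D}` of the tree's global bound `PolymerLogZLipschitz.norm_polymerLogZ_sub_polymerLogZ_le`, proved here directly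
from the identity), `Σ_{C ⊆ Λ, C∩D ≠ ∅} Φ^T(C) = log Z(Λ) − log Z(Λ∖D)` with NO hypothesis (`sum_truncatedWeight_meet_eq`,
Möbius inversion (2) for `Λ` and `Λ∖D`) and `norm_sum_truncatedWeight_meet_le`; (§2) at the level of coupling-dependent
activities — `differentiableOn_logZ`: `z ↦ log Z(Λ'; w(·,z))` is holomorphic on an ARBITRARY set `U` (not necessarily open —
the consumers' `U` is a union of CLOSED discs) under `IsKPOn`, adding the polymers one at a time, each step the principal
logarithm of a holomorphic zero-free ratio with values in `|ζ − 1| ≤ 1/2` (the tree's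
`PolymerPressureAnalytic.differentiableOn_polymerLogZ_param` gives this on OPEN sets of a general parameter space by the
continuous-logarithm argument); `differentiableOn_truncatedWeight`; the piece logarithm `pieceLog` with
`pieceLog_eq_logZ_sub`, `cexp_neg_pieceLog` (`= pieceRatio`, BY NAME), `differentiableOn_pieceLog`, `norm_pieceLog_le`
(`≤ Σ_D a` in every volume), `logZ_differentiableOn_and_bound` (the free energy itself: holomorphic, EXTENSIVE bound
`Σ_Λ a`); (§3) `pieceLog_dilationAnalytic` — LITERALLY the `hlast` shape
`∃ Dm, DifferentiableOn ℂ W_D Dm ∧ (∀ z ∈ Dm, ‖W_D z‖ ≤ Σ_D a) ∧ ∀ s ≥ t₀, closedBall s (c s) ⊆ Dm`, and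
`pieceLog_lipschitz(_allVolumes)` (`Dimock2015.real_param_lipschitz` BY NAME): Lipschitz constant `4(Σ_D a)/(c t₀)` in every
volume; (§4) DECAY — the `d`-weighted condition uniformly on `U` (`IsWKPOn`, `IsWKPOn.isKPOn`), the far cluster sum `farSum`
(clusters `C ∋ γ` with `Σ_{C} d ≥ r`), `norm_farSum_le`: `‖farSum‖ ≤ a γ·e^{−r}` from the tree's finite-volume estimate (4)
(`ClusterExpansionKPBound.touchSum_le_of_kp` through `T4ActivityLipschitz.sum_norm_truncatedWeight_le_of_pin`, BY NAME),
`differentiableOn_farSum`, `farSum_dilationAnalytic` — the `hlast` shape with a constant DECAYING in the size of the piece,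
which is how `M₁ j = M e^{−A₀ (log t_j)^{p₀}}` of `hlast` is shaped; the decay is hypothesis (1)-with-`d` at COMPLEX
coupling, nothing here produces it; (§5) NON-VACUITY: §3 fires on `T4DilationKP`'s one-polymer example
(`expActivity_pieceLog_lipschitz`).

RELATION TO THE TREE'S ENGINES (lean-in-tree rule: cite, do not re-prove).  The analytic content is standard and largely in
the tree already: [KP86] zero-freeness and ratio bounds (`ClusterExpansion`), estimate (4) PROVED
(`ClusterExpansionKPBound.touchSum_le_of_kp`, `koteckyPreiss_truncatedWeight_bound_holds`), holomorphy of the KP logarithm in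
a parameter on open sets (`PolymerPressureAnalytic.differentiableOn_polymerLogZ_param`; for cell factors / plaquette systems
`LocalFactorKPLogParam`, `PlaqSystemLogZAnalytic`), Lipschitz continuity of `log Z` and of `Φ^T` in the activities
(`PolymerLogZLipschitz`, `TruncatedWeightLipschitz`), and — closest — the sibling seat NE5-P2's `T4ActivityLipschitz` §8
(`touchDiffSum_le_of_kp_disc_family`: Cauchy's estimate for generating functions of the `Φ^T` over a PENCIL DISC of activity
families under uniform weighted KP).  NEW here are only the principal-logarithm deletion identity with the holomorphy on
non-open `U` it yields (§1–§2), and the bookkeeping of [H-dil-N]'s COUPLING-DILATION geometry at the logarithmic level with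
additive, volume-uniform (§3) and size-decaying (§4) constants.  No new analytic idea is claimed.

DICTIONARY (model ↦ print; an ANALOGY fixing what is modelled, NOT an identification; transcriptions from the renders, cell
record `t4/T4-EST-NE9-P1.md` §18, GAPS [H-dil-N] UPDATE 10).  `pieceLog Λ D z` ↦ a localised term of an effective action,
[Balaban1988RG2Cluster] p. 14 (2.13) *"E^{(k+1)}(X) = Σ_{n=1}^∞ (1/n!) Σ_{(Z_1,…,Z_n): ∪Z_i = X} ρ^T(Z_1,…,Z_n)H(Z_1)…H(Z_n),
(2.13) where X ∈ 𝐃_{k+1}"* (print localises a cluster by the UNION of its domains; the model's piece «clusters meeting D» is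
the [KP86, (5)] localisation; `farSum` ↦ the terms with large `d_{k+1}(X)`); `a`, `d` ↦ the combinatorial size and the decay
weight `κ d_k(X)` of such expansions (B13 (1.36), (2.30)); `z` ↦ the last coupling `t = 1/g²` of [H-dil-N]; `IsKPOn` /
`IsWKPOn` (a KP condition for the COMPLEX-COUPLING activities, uniformly on the discs) ↦ NOT PRINTED — located this
generation: the complex variables of B13 §2 are the interpolation parameters `σ(Δ), τ(Y)` (Cauchy integrals (2.14), p. 15)
and the complexified fields, p. 15 *"Thus the activities in (2.13), and the whole sum E^{(k+1)}(X), are analytic functions of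
(𝐔, 𝐉), on the space 𝐔^c_{k+1}(X, α₀, α₁). This is the analyticity statement in the inductive assumptions."*;
[Balaban1988Convergent] p. 259 (2.27)(ii) is analyticity in `(𝐔, 𝐉)` (its `z` is a lattice point) and Thm 1 p. 262 takes a
REAL sequence `{g_k}`; the ONLY printed sentence on analyticity in the couplings is [Balaban1987RG1] p. 266, after (2.9):
*"Another possibility is to take g_k/γ_kε₁ instead of ε₁, where γ_k = C log(L^kε)^{−1} with C sufficiently large. It has the
advantage that the functions E^{(j)}, β_j are analytic functions of the effective coupling constants, but it has some
disadvantages in perturbative calculations also. We have formulated the implications of both possibilities in the inductive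
description."* — an alternative small-field cut-off, stated without domain or bound and not the one adopted in B13/B14 (whose
characteristic functions use `ε₁/g_k`, B13 (2.3)); it is context, NOT a source for [H-dil-N].  Fluctuation variables per
localised `X` (the `ν` of `T4DilationAperture`, charged per polymer by `T4DilationKP.isKPOn_of_dominated`): B13 p. 13 (cubes of
`π_{k+1}` of size `LM`), p. 12 (2.3)/(2.5) (bond variables `b ∈ T_1^{(k)*}`): at most `4(LM)⁴·N_{k+1}(X)` with
`N_{k+1}(X) ≤ 24(1 + d_{k+1}(X))` by the REPAIRED tree-length inequality (GAPS G-B13-07, tree `TreeLength`) — step-independent,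
consistent with the model's «ν(1+d)» as a count (an analogy: the model's variables are real Gaussian coordinates).  The
abstract KP gas is NOT Bałaban's expansion (multi-scale, 𝐑-operation, large-field holes); the model isolates the MECHANISM.

## What is typed and proved (all [folklore]; 0 sorry)

§1 `norm_log_one_add_le_of_le` (`‖u‖ ≤ x e^{−x} ⇒ ‖Log(1+u)‖ ≤ x`), `mem_slitPlane_of_norm_sub_one_le`,
   `hasDerivAt_polymerRayPrimitive` (FTC for `s ↦ ∫₀ˢ Z′/Z`), **`polymerLogZ_eq_erase_add_log`** (deletion identity), `norm_log_div_erase_le`,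
   **`norm_polymerLogZ_sub_sdiff_le`**, `norm_polymerLogZ_le`, `sum_truncatedWeight_meet_eq`, `norm_sum_truncatedWeight_meet_le`.
§2 **`differentiableOn_logZ`**, `differentiableOn_truncatedWeight`, `pieceLog`, `pieceLog_eq_logZ_sub`, `cexp_neg_pieceLog`,
   **`differentiableOn_pieceLog`**, **`norm_pieceLog_le`**, `logZ_differentiableOn_and_bound`.
§3 **`pieceLog_dilationAnalytic`** (the `hlast` shape, additive volume-uniform constant), **`pieceLog_lipschitz`**
   (`4(Σ_D a)/(c t₀)`), `pieceLog_lipschitz_allVolumes`.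
§4 `IsWKPOn`, `IsWKPOn.isKPOn`, `farSum`, **`norm_farSum_le`** (`a γ·e^{−r}`, estimate (4) BY NAME), `differentiableOn_farSum`,
   **`farSum_dilationAnalytic`**.
§5 `expActivity_pieceLog_lipschitz`.

WHAT THIS SHOWS AND WHAT IT DOES NOT.  Shows (kernel, MODEL): on the expansion branch the LOGARITHMIC object has the `hlast`
shape with ADDITIVE volume-uniform constants (`Σ_D a`), and for far pieces size-decaying ones (`a γ e^{−r}`), from exactly two
hypotheses at COMPLEX coupling — holomorphic activities and a (weighted) Kotecký–Preiss condition uniform on a set containing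
the dilation discs; no openness of that set is needed.  Does NOT show: that Bałaban's activities `H(Z)` of (2.11) are
holomorphic in the COUPLING with such a criterion (NOT PRINTED: this is [H-dil-N] on this branch — print's analyticity is in
`(𝐔, 𝐉)`, `σ`, `τ`), any value of `a`, `d`, `c` for the printed scheme, anything about large fields or the 𝐑-operation, nor
NE9.  The typed wall of node U3 is UNCHANGED: `hlast` of `T4CouplingAnalyticity.stepTransferV_of_analyticOn` for Bałaban's
step, (W2)–(W4), G-ne9p1-13 (record §4, §16–§18) — this leaf completes the branch-resolved reading of [H-dil-N]: domination
branch = aperture rider (UPDATE 8), expansion branch = `IsKPOn`/`IsWKPOn`-type criterion at complex coupling for the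
activities, whose consequences for ratios (generation 10) AND logarithms (this leaf) are kernel theorems (UPDATES 9–11).

CITATION HEADER (lean-in-tree rule 2026-08-18).  Kernel inputs used BY NAME (published, outside the audited series, proved in
the tree): R. Kotecký, D. Preiss, *Cluster expansion for abstract polymer models*, Commun. Math. Phys. **103** (1986)
491–498 [KoteckyPreiss1986] — via `Literature.Probability.LatticeModels.{PolymerGas, ClusterExpansion,
ClusterExpansionKPBound, TruncatedWeightLipschitz, PolymerPressure, PolymerGasRatio}` (`polymerPartitionFunction_kp_bounds`,
`polymerPartitionFunction_ne_zero_of_kp`, `IsKPVolume.ray`, `hasDerivAt_polymerPartitionFunction_ray`, `polymerPartitionFunction_zero_mul`,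
`polymerLogZ_eq_sum_truncatedWeight`, `kpTerm_nonneg`, `polymerLogZ_empty`, `isKPVolume_of_kpd`, `KPTouches`; estimate (4) in
finite volume, `touchSum_le_of_kp`, through `T4ActivityLipschitz.sum_norm_truncatedWeight_le_of_pin` of unit
b2b-balaban-t4-ne5-p2, accepted); `T4DilationKP` v1 (p191997: `IsKPOn`, `cZ`, `differentiableOn_cZ`, `cZ_ne_zero`,
`pieceRatio`, `pieceRatio_eq_exp`, `sum_kpTerm_le_sum`, `topInc`, `expActivity`, `isKPOn_expActivity`,
`differentiable_expActivity`, `closedBall_subset_halfPlane`); `Dimock2015.AnalyticLipschitz.real_param_lipschitz` (J. Dimock's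
printed "analyticity ⇒ Lipschitz" mechanism [Dimock2015]/[DimockYuan2024GNFlow], PUBLISHED, outside the audited series);
Mathlib (`HasDerivAt.clog_real`, `DifferentiableOn.clog`, `Complex.mem_slitPlane_of_norm_lt_one`, `Complex.norm_log_one_add_le`,
`intervalIntegral.integral_hasDerivAt_right`, `constant_of_has_deriv_right_zero`); it modifies nothing.  Sources quoted for
STRUCTURE/CONTEXT only: T. Bałaban, *Renormalization group approach to lattice gauge field theories. II. Cluster
expansions*, Commun. Math. Phys. **116**, 1–22 (1988) [Balaban1988RG2Cluster] (cell paper B13; pp. 12–15);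
[Balaban1987RG1] (B12) p. 266; [Balaban1988Convergent] (B14) pp. 259, 262.  Named for framing only:
[Balaban1989LargeFieldII] (B16).  The Bałaban papers are manuscripts UNDER ADJUDICATION by the audit cell `pub-balaban`:
NOTHING printed in them is asserted here.  NEW LEAF of unit `b2b-balaban-t4-ne9-p1-g11` (NE9 prover P1, analytic-dependence
route, generation 11; journal CLAIM T4-U3.E-NE9-PROVE-P1k* 2026-08-19T17:46Z; companion of `T4DilationKP` v1 p191997); v1.
-/

noncomputable section

open Complex MeasureTheory Set Metric Finset
open scoped BigOperators
open Literature.Probability.LatticeModels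
open Literature.MathematicalPhysics.QuantumFieldTheory.Balaban1983to89.T4DilationKP

namespace Literature.MathematicalPhysics.QuantumFieldTheory.Balaban1983to89.T4DilationKPLog

variable {P : Type*} [DecidableEq P] {inc : P → P → Prop} [DecidableRel inc]

/-! ## §1  The deletion identity for the Kotecký–Preiss logarithm (activity level) -/

/-- **Elementary logarithm bound.**  If `‖u‖ ≤ x·e^{−x}` with `x ≥ 0` then `‖Log(1 + u)‖ ≤ x` (principal branch):
`‖u‖ ≤ 1/2`, so `‖Log(1+u)‖ ≤ ‖u‖²/(2(1−‖u‖)) + ‖u‖ ≤ ‖u‖² + ‖u‖ ≤ x e^{−x}(1 + x) ≤ x`. [folklore] -/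
theorem norm_log_one_add_le_of_le {u : ℂ} {x : ℝ} (hx : 0 ≤ x) (hu : ‖u‖ ≤ x * Real.exp (-x)) :
    ‖Complex.log (1 + u)‖ ≤ x := by
  have hp : x * Real.exp (-x) ≤ 1 / 2 := by
    -- `2x ≤ 1 + x + x²/2 ≤ eˣ` (also landed as `Literature.Analysis.FluidPDE.mul_exp_neg_le_half`; inlined to keep the
    -- import closure topical)
    have hq : 1 + x + x ^ 2 / 2 ≤ Real.exp x := Real.quadratic_le_exp_of_nonneg hx
    have h2x : 2 * x ≤ Real.exp x := by nlinarith [sq_nonneg (x - 1)]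
    rw [Real.exp_neg, mul_inv_le_iff₀ (Real.exp_pos x)]
    linarith
  have hq0 : 0 ≤ ‖u‖ := norm_nonneg _
  have hq1 : ‖u‖ ≤ 1 / 2 := hu.trans hp
  have hqlt : ‖u‖ < 1 := by linarith
  have h := Complex.norm_log_one_add_le hqlt
  have h2 : ‖u‖ ^ 2 * (1 - ‖u‖)⁻¹ / 2 ≤ ‖u‖ ^ 2 := by
    have h1q : (1 - ‖u‖)⁻¹ ≤ 2 := by
      rw [inv_le_comm₀ (by linarith) (by norm_num)]
      linarith
    calc ‖u‖ ^ 2 * (1 - ‖u‖)⁻¹ / 2 ≤ ‖u‖ ^ 2 * 2 / 2 := by gcongr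
      _ = ‖u‖ ^ 2 := by ring
  have hpx : x * Real.exp (-x) * (1 + x * Real.exp (-x)) ≤ x := by
    have hex : Real.exp (-x) ≤ 1 := by rw [Real.exp_le_one_iff]; linarith
    have h1x : 1 + x ≤ Real.exp x := by linarith [Real.add_one_le_exp x]
    have hxe : 0 ≤ x * Real.exp (-x) := mul_nonneg hx (Real.exp_nonneg _)
    calc x * Real.exp (-x) * (1 + x * Real.exp (-x)) ≤ x * Real.exp (-x) * (1 + x) := by
          gcongr; exact mul_le_of_le_one_right hx hex
      _ ≤ x * Real.exp (-x) * Real.exp x := by gcongr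
      _ = x := by rw [mul_assoc, ← Real.exp_add, neg_add_cancel, Real.exp_zero, mul_one]
  calc ‖Complex.log (1 + u)‖ ≤ ‖u‖ ^ 2 * (1 - ‖u‖)⁻¹ / 2 + ‖u‖ := h
    _ ≤ ‖u‖ ^ 2 + ‖u‖ := by linarith
    _ ≤ (x * Real.exp (-x)) ^ 2 + x * Real.exp (-x) := by gcongr
    _ = x * Real.exp (-x) * (1 + x * Real.exp (-x)) := by ring
    _ ≤ x := hpx

/-- **The KP one-step ratio lies in the slit plane**: `‖ζ − 1‖ ≤ x e^{−x} < 1` (`x < x + 1 ≤ eˣ`, any real `x`),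
hence `ζ ∈ ℂ ∖ ]−∞, 0]` (and, for `x ≥ 0`, `norm_log_one_add_le_of_le` bounds its logarithm by `x`). [folklore] -/
theorem mem_slitPlane_of_norm_sub_one_le {ζ : ℂ} {x : ℝ} (h : ‖ζ - 1‖ ≤ x * Real.exp (-x)) :
    ζ ∈ slitPlane := by
  have hp : x * Real.exp (-x) < 1 := by
    rw [Real.exp_neg, mul_inv_lt_iff₀ (Real.exp_pos x)]
    linarith [Real.add_one_le_exp x]
  have hm := mem_slitPlane_of_norm_lt_one (lt_of_le_of_lt h hp)
  rwa [add_sub_cancel] at hm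

/-- **FTC for the ray primitive** `s ↦ ∫₀ˢ Z′/Z` of a volume whose partition function is zero-free along the ray
`[0,1]•w`: it is differentiable on `[0,1]` with derivative `Z′(s)/Z(s)` (the step inside the tree's `exp_polymerLogZ`,
isolated). [folklore] -/
theorem hasDerivAt_polymerRayPrimitive {w : P → ℂ} {Λ : Finset P}
    (hZ : ∀ t ∈ Set.Icc (0 : ℝ) 1, polymerPartitionFunction inc (fun γ => (t : ℂ) * w γ) Λ ≠ 0)
    {s : ℝ} (hs : s ∈ Set.Icc (0 : ℝ) 1) :
    HasDerivAt (fun u : ℝ => ∫ t in (0 : ℝ)..u,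
        polymerRayDeriv inc w Λ t / polymerPartitionFunction inc (fun γ => (t : ℂ) * w γ) Λ)
      (polymerRayDeriv inc w Λ s / polymerPartitionFunction inc (fun γ => (s : ℂ) * w γ) Λ) s := by
  set Z : ℝ → ℂ := fun s => polymerPartitionFunction inc (fun γ => (s : ℂ) * w γ) Λ with hZdef
  set Z' : ℝ → ℂ := polymerRayDeriv inc w Λ with hZ'def
  set q : ℝ → ℂ := fun s => Z' s / Z s with hq
  have hZd : ∀ s, HasDerivAt Z (Z' s) s := hasDerivAt_polymerPartitionFunction_ray w Λ
  have hZc : Continuous Z := continuous_iff_continuousAt.2 fun s => (hZd s).continuousAt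
  have hZ'c : Continuous Z' := by rw [hZ'def]; unfold polymerRayDeriv; fun_prop
  set U : Set ℝ := {s | Z s ≠ 0} with hU
  have hUo : IsOpen U := isOpen_ne_fun hZc continuous_const
  have hIU : Set.Icc (0 : ℝ) 1 ⊆ U := fun s hs => hZ s hs
  have hqU : ContinuousOn q U := (hZ'c.continuousOn).div hZc.continuousOn fun s hs => hs
  have hint : IntervalIntegrable q MeasureTheory.volume 0 s :=
    (hqU.mono ((Set.uIcc_of_le hs.1).symm ▸ Set.Icc_subset_Icc_right hs.2 |>.trans hIU)).intervalIntegrable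
  exact intervalIntegral.integral_hasDerivAt_right hint
    (hqU.stronglyMeasurableAtFilter hUo s (hIU hs)) (hqU.continuousAt (hUo.mem_nhds (hIU hs)))

/-- **THE DELETION IDENTITY FOR THE KP LOGARITHM.**  In a KP volume `Λ ⊇ Λ' ∋ γ`:
`log Z(Λ') = log Z(Λ' ∖ γ) + Log (Z(Λ')/Z(Λ' ∖ γ))` with the PRINCIPAL logarithm of the ratio — which is close to `1`
(`‖Z(Λ')/Z(Λ'∖γ) − 1‖ ≤ x e^{−x} ≤ 1/2`, `x = |w γ|e^{a γ}`, `polymerPartitionFunction_kp_bounds`).  Proof: along the ray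
`s•w` both sides have the same derivative (`Z′/Z` of each volume by the FTC, `(Z₁/Z₂)′/(Z₁/Z₂)` by the chain rule for the
principal logarithm on the slit plane; the ray stays KP by the tree's `IsKPVolume.ray`) and agree at `s = 0`.
[cite: KoteckyPreiss1986, Theorem p. 492 and its proof p. 493–494] -/
theorem polymerLogZ_eq_erase_add_log [Std.Refl inc] [Std.Symm inc] {w : P → ℂ} {a : P → ℝ} {Λ Λ' : Finset P}
    (hKP : IsKPVolume inc w a Λ) (hΛ' : Λ' ⊆ Λ) {γ : P} (hγ : γ ∈ Λ') :
    polymerLogZ inc w Λ' = polymerLogZ inc w (Λ'.erase γ) +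
      Complex.log (polymerPartitionFunction inc w Λ' / polymerPartitionFunction inc w (Λ'.erase γ)) := by
  have hΛ'' : Λ'.erase γ ⊆ Λ := (Finset.erase_subset γ Λ').trans hΛ'
  set Z₁ : ℝ → ℂ := fun s => polymerPartitionFunction inc (fun γ => (s : ℂ) * w γ) Λ' with hZ₁
  set Z₂ : ℝ → ℂ := fun s => polymerPartitionFunction inc (fun γ => (s : ℂ) * w γ) (Λ'.erase γ) with hZ₂
  set Z₁' : ℝ → ℂ := polymerRayDeriv inc w Λ' with hZ₁'
  set Z₂' : ℝ → ℂ := polymerRayDeriv inc w (Λ'.erase γ) with hZ₂'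
  set G₁ : ℝ → ℂ := fun u => ∫ t in (0 : ℝ)..u, Z₁' t / Z₁ t with hG₁
  set G₂ : ℝ → ℂ := fun u => ∫ t in (0 : ℝ)..u, Z₂' t / Z₂ t with hG₂
  have hne₁ : ∀ s ∈ Set.Icc (0 : ℝ) 1, Z₁ s ≠ 0 := fun s hs =>
    polymerPartitionFunction_ne_zero_of_kp (hKP.ray hs) hΛ'
  have hne₂ : ∀ s ∈ Set.Icc (0 : ℝ) 1, Z₂ s ≠ 0 := fun s hs =>
    polymerPartitionFunction_ne_zero_of_kp (hKP.ray hs) hΛ''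
  have hslit : ∀ s ∈ Set.Icc (0 : ℝ) 1, Z₁ s / Z₂ s ∈ slitPlane := by
    intro s hs
    have hb := ((polymerPartitionFunction_kp_bounds (hKP.ray hs) Λ' hΛ').2 γ hγ).2.2
    exact mem_slitPlane_of_norm_sub_one_le hb
  have hd₁ : ∀ s, HasDerivAt Z₁ (Z₁' s) s := hasDerivAt_polymerPartitionFunction_ray w Λ'
  have hd₂ : ∀ s, HasDerivAt Z₂ (Z₂' s) s := hasDerivAt_polymerPartitionFunction_ray w (Λ'.erase γ)
  have hG₁d : ∀ s ∈ Set.Icc (0 : ℝ) 1, HasDerivAt G₁ (Z₁' s / Z₁ s) s := fun s hs =>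
    hasDerivAt_polymerRayPrimitive hne₁ hs
  have hG₂d : ∀ s ∈ Set.Icc (0 : ℝ) 1, HasDerivAt G₂ (Z₂' s / Z₂ s) s := fun s hs =>
    hasDerivAt_polymerRayPrimitive hne₂ hs
  set ψ : ℝ → ℂ := fun s => G₁ s - G₂ s - Complex.log (Z₁ s / Z₂ s) with hψ
  have hψd : ∀ s ∈ Set.Icc (0 : ℝ) 1, HasDerivAt ψ 0 s := by
    intro s hs
    have h1 := hne₁ s hs
    have h2 := hne₂ s hs
    have hR : HasDerivAt (fun u => Z₁ u / Z₂ u) ((Z₁' s * Z₂ s - Z₁ s * Z₂' s) / Z₂ s ^ 2) s :=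
      (hd₁ s).div (hd₂ s) h2
    have hL := hR.clog_real (hslit s hs)
    have h := ((hG₁d s hs).sub (hG₂d s hs)).sub hL
    refine h.congr_deriv ?_
    field_simp
    ring
  have hconst := constant_of_has_deriv_right_zero (f := ψ) (a := 0) (b := 1)
    (fun s hs => (hψd s hs).continuousAt.continuousWithinAt)
    (fun s hs => (hψd s (Set.Ico_subset_Icc_self hs)).hasDerivWithinAt)
  have h01 := hconst 1 ⟨zero_le_one, le_rfl⟩
  have hZ₁0 : Z₁ 0 = 1 := by
    simp only [hZ₁, Complex.ofReal_zero]; exact polymerPartitionFunction_zero_mul w Λ'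
  have hZ₂0 : Z₂ 0 = 1 := by
    simp only [hZ₂, Complex.ofReal_zero]; exact polymerPartitionFunction_zero_mul w _
  have hZ₁1 : Z₁ 1 = polymerPartitionFunction inc w Λ' := by
    simp only [hZ₁, Complex.ofReal_one, one_mul]
  have hZ₂1 : Z₂ 1 = polymerPartitionFunction inc w (Λ'.erase γ) := by
    simp only [hZ₂, Complex.ofReal_one, one_mul]
  have hG₁1 : G₁ 1 = polymerLogZ inc w Λ' := rfl
  have hG₂1 : G₂ 1 = polymerLogZ inc w (Λ'.erase γ) := rfl
  have hψ0 : ψ 0 = 0 := by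
    show G₁ 0 - G₂ 0 - Complex.log (Z₁ 0 / Z₂ 0) = 0
    rw [hZ₁0, hZ₂0]
    simp [hG₁, hG₂]
  have hψ1 : ψ 1 = polymerLogZ inc w Λ' - polymerLogZ inc w (Λ'.erase γ) -
      Complex.log (polymerPartitionFunction inc w Λ' / polymerPartitionFunction inc w (Λ'.erase γ)) := by
    show G₁ 1 - G₂ 1 - Complex.log (Z₁ 1 / Z₂ 1) = _
    rw [hG₁1, hG₂1, hZ₁1, hZ₂1]
  rw [hψ1, hψ0] at h01
  linear_combination h01

/-- **The deleted factor costs at most one KP term in the logarithm**: `‖Log (Z(Λ')/Z(Λ'∖γ))‖ ≤ |w γ| e^{a γ}`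
(`‖ratio − 1‖ ≤ x e^{−x}` and `norm_log_one_add_le_of_le`). [cite: KoteckyPreiss1986, Theorem p. 492 and its proof] -/
theorem norm_log_div_erase_le [Std.Refl inc] [Std.Symm inc] {w : P → ℂ} {a : P → ℝ} {Λ Λ' : Finset P}
    (hKP : IsKPVolume inc w a Λ) (hΛ' : Λ' ⊆ Λ) {γ : P} (hγ : γ ∈ Λ') :
    ‖Complex.log (polymerPartitionFunction inc w Λ' / polymerPartitionFunction inc w (Λ'.erase γ))‖
      ≤ kpTerm w a γ := by
  have hb := ((polymerPartitionFunction_kp_bounds hKP Λ' hΛ').2 γ hγ).2.2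
  have h := norm_log_one_add_le_of_le (kpTerm_nonneg w a γ) hb
  rwa [add_sub_cancel] at h

/-- **BOUND ON LOG-RATIOS OF PARTITION FUNCTIONS.**  In a KP volume `Λ ⊇ Λ' ⊇ D`:
`‖log Z(Λ') − log Z(Λ' ∖ D)‖ ≤ Σ_{γ ∈ D} |w γ| e^{a γ}` — delete the polymers of `D` one at a time
(`polymerLogZ_eq_erase_add_log`, `norm_log_div_erase_le`).  (The special case `wB = w·1_{∉D}` of the tree's
`norm_polymerLogZ_sub_polymerLogZ_le`, in the `Λ' ∖ D` currency the pieces use.) [cite: KoteckyPreiss1986, Theorem p. 492,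
(5) with (4)] -/
theorem norm_polymerLogZ_sub_sdiff_le [Std.Refl inc] [Std.Symm inc] {w : P → ℂ} {a : P → ℝ} {Λ Λ' : Finset P}
    (hKP : IsKPVolume inc w a Λ) (hΛ' : Λ' ⊆ Λ) {D : Finset P} (hD : D ⊆ Λ') :
    ‖polymerLogZ inc w Λ' - polymerLogZ inc w (Λ' \ D)‖ ≤ ∑ γ ∈ D, kpTerm w a γ := by
  induction D using Finset.induction_on with
  | empty => simp
  | insert γ D hγD ih =>
    have hγ : γ ∈ Λ' := hD (Finset.mem_insert_self γ D)
    have hDΛ' : D ⊆ Λ' := (Finset.subset_insert γ D).trans hD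
    have hγ' : γ ∈ Λ' \ D := Finset.mem_sdiff.2 ⟨hγ, hγD⟩
    have hsub : Λ' \ D ⊆ Λ := Finset.sdiff_subset.trans hΛ'
    rw [Finset.sdiff_insert, Finset.sum_insert hγD]
    have hdel := polymerLogZ_eq_erase_add_log hKP hsub hγ'
    have hsplit : polymerLogZ inc w Λ' - polymerLogZ inc w ((Λ' \ D).erase γ) =
        (polymerLogZ inc w Λ' - polymerLogZ inc w (Λ' \ D)) +
          Complex.log (polymerPartitionFunction inc w (Λ' \ D) /
            polymerPartitionFunction inc w ((Λ' \ D).erase γ)) := by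
      rw [hdel]; ring
    rw [hsplit, add_comm (kpTerm w a γ)]
    exact (norm_add_le _ _).trans (add_le_add (ih hDΛ') (norm_log_div_erase_le hKP hsub hγ'))

/-- **Free-energy bound**: `‖log Z(Λ')‖ ≤ Σ_{γ ∈ Λ'} |w γ| e^{a γ}` in a KP volume `Λ ⊇ Λ'` (`polymerLogZ_empty` of the
tree). [cite: KoteckyPreiss1986, Theorem p. 492] -/
theorem norm_polymerLogZ_le [Std.Refl inc] [Std.Symm inc] {w : P → ℂ} {a : P → ℝ} {Λ Λ' : Finset P}
    (hKP : IsKPVolume inc w a Λ) (hΛ' : Λ' ⊆ Λ) :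
    ‖polymerLogZ inc w Λ'‖ ≤ ∑ γ ∈ Λ', kpTerm w a γ := by
  have h := norm_polymerLogZ_sub_sdiff_le hKP hΛ' (Finset.Subset.refl Λ')
  rwa [Finset.sdiff_self, polymerLogZ_empty, sub_zero] at h

/-- **The cluster sum through a piece is a difference of logarithms** (no hypothesis — Möbius inversion (2) for `Λ` and
`Λ ∖ D`): `Σ_{C ⊆ Λ, C ∩ D ≠ ∅} Φ^T(C) = log Z(Λ) − log Z(Λ ∖ D)`. [cite: KoteckyPreiss1986, (2) and (5) p. 492] -/
theorem sum_truncatedWeight_meet_eq (w : P → ℂ) (Λ D : Finset P) :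
    ∑ C ∈ Λ.powerset with (C ∩ D).Nonempty, truncatedWeight inc w C =
      polymerLogZ inc w Λ - polymerLogZ inc w (Λ \ D) := by
  rw [polymerLogZ_eq_sum_truncatedWeight, polymerLogZ_eq_sum_truncatedWeight,
    ← Finset.sum_filter_add_sum_filter_not Λ.powerset (fun C => (C ∩ D).Nonempty)]
  have hset : Λ.powerset.filter (fun C => ¬ (C ∩ D).Nonempty) = (Λ \ D).powerset := by
    ext C
    simp only [Finset.mem_filter, Finset.mem_powerset, Finset.not_nonempty_iff_eq_empty,
      Finset.subset_sdiff, Finset.disjoint_iff_inter_eq_empty]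
  rw [hset]
  ring

/-- **KP BOUND ON THE CLUSTER SUM THROUGH A PIECE** (finite volume):
`‖Σ_{C ⊆ Λ, C ∩ D ≠ ∅} Φ^T(C)‖ ≤ Σ_{γ ∈ D} |w γ| e^{a γ}` for `D ⊆ Λ` a KP volume (cf. the tree's
`norm_sum_truncatedWeight_le`, the countable-polymer-set form over arbitrary families via (4)). [cite: KoteckyPreiss1986,
Theorem p. 492] -/
theorem norm_sum_truncatedWeight_meet_le [Std.Refl inc] [Std.Symm inc] {w : P → ℂ} {a : P → ℝ}
    {Λ D : Finset P} (hKP : IsKPVolume inc w a Λ) (hD : D ⊆ Λ) :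
    ‖∑ C ∈ Λ.powerset with (C ∩ D).Nonempty, truncatedWeight inc w C‖ ≤ ∑ γ ∈ D, kpTerm w a γ := by
  rw [sum_truncatedWeight_meet_eq]
  exact norm_polymerLogZ_sub_sdiff_le hKP (Finset.Subset.refl Λ) hD

/-! ## §2  Coupling-dependent activities: holomorphy of the KP logarithm and of the piece logarithms -/

/-- **HOLOMORPHY OF THE KP LOGARITHM IN THE COUPLING, ON AN ARBITRARY SET.**  If the activities are holomorphic on `U`
and satisfy KP on `Λ` UNIFORMLY on `U` (`IsKPOn`), then `z ↦ log Z(Λ'; w(·,z))` is holomorphic on `U` for every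
`Λ' ⊆ Λ` — add the polymers one at a time: each step adds the principal logarithm of a holomorphic ratio with values in
the disc `|ζ − 1| ≤ 1/2` (`polymerLogZ_eq_erase_add_log`).  `U` need not be open (cf. the tree's
`differentiableOn_polymerLogZ_param`: open sets of a general parameter space, continuous-logarithm argument). [folklore] -/
theorem differentiableOn_logZ [Std.Refl inc] [Std.Symm inc] {w : P → ℂ → ℂ} {a : P → ℝ} {Λ : Finset P}
    {U : Set ℂ} (hw : ∀ γ ∈ Λ, DifferentiableOn ℂ (w γ) U) (h : IsKPOn inc w a Λ U) :
    ∀ Λ' ⊆ Λ, DifferentiableOn ℂ (fun z => polymerLogZ inc (fun γ => w γ z) Λ') U := by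
  intro Λ'
  induction Λ' using Finset.induction_on with
  | empty =>
    intro _
    simp only [polymerLogZ_empty]
    exact differentiableOn_const 0
  | insert γ₀ S hγS ih =>
    intro hsub
    have hS : S ⊆ Λ := (Finset.subset_insert γ₀ S).trans hsub
    have hγ₀ : γ₀ ∈ insert γ₀ S := Finset.mem_insert_self γ₀ S
    have heq : ∀ z ∈ U, polymerLogZ inc (fun γ => w γ z) (insert γ₀ S) =
        polymerLogZ inc (fun γ => w γ z) S + Complex.log (cZ inc w (insert γ₀ S) z / cZ inc w S z) := by
      intro z hz
      have h1 := polymerLogZ_eq_erase_add_log (h z hz) hsub hγ₀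
      rw [Finset.erase_insert hγS] at h1
      exact h1
    have hrat : DifferentiableOn ℂ (fun z => cZ inc w (insert γ₀ S) z / cZ inc w S z) U :=
      (differentiableOn_cZ w _ fun γ hγ => hw γ (hsub hγ)).div
        (differentiableOn_cZ w _ fun γ hγ => hw γ (hS hγ)) fun z hz => cZ_ne_zero h hS hz
    have hslit : ∀ z ∈ U, cZ inc w (insert γ₀ S) z / cZ inc w S z ∈ slitPlane := by
      intro z hz
      have hb := ((polymerPartitionFunction_kp_bounds (h z hz) _ hsub).2 γ₀ hγ₀).2.2
      rw [Finset.erase_insert hγS] at hb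
      unfold cZ
      exact mem_slitPlane_of_norm_sub_one_le hb
    exact ((ih hS).add (hrat.clog hslit)).congr fun z hz => heq z hz

/-- **Holomorphy of the Ursell functions** `z ↦ Φ^T(C; w(·,z))`, `C ⊆ Λ` (finite alternating sums of the `log Z(B)`,
`B ⊆ C`). [folklore] -/
theorem differentiableOn_truncatedWeight [Std.Refl inc] [Std.Symm inc] {w : P → ℂ → ℂ} {a : P → ℝ}
    {Λ : Finset P} {U : Set ℂ} (hw : ∀ γ ∈ Λ, DifferentiableOn ℂ (w γ) U) (h : IsKPOn inc w a Λ U)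
    {C : Finset P} (hC : C ⊆ Λ) :
    DifferentiableOn ℂ (fun z => truncatedWeight inc (fun γ => w γ z) C) U := by
  unfold truncatedWeight
  refine DifferentiableOn.fun_sum fun B hB => ?_
  exact (differentiableOn_const _).mul (differentiableOn_logZ hw h B ((Finset.mem_powerset.1 hB).trans hC))

/-- **The piece logarithm** of `D ⊆ Λ` at complex coupling `z`: the cluster sum through the piece,
`W_D(z) = Σ_{C ⊆ Λ, C ∩ D ≠ ∅} Φ^T(C; w(·,z))` — minus the logarithm of the reduced activity, `exp(−W_D) = Z(Λ∖D)/Z(Λ)`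
(`cexp_neg_pieceLog`); `T4ActivityLipschitz.clusterSum` over the family `{C ⊆ Λ : C ∩ D ≠ ∅}` at the activity vector
`w(·,z)`.  In the DICTIONARY of the header, the model of ONE localised term of an effective action. [cite: KoteckyPreiss1986,
(5) p. 492] -/
def pieceLog (inc : P → P → Prop) [DecidableRel inc] (w : P → ℂ → ℂ) (Λ D : Finset P) (z : ℂ) : ℂ :=
  ∑ C ∈ Λ.powerset with (C ∩ D).Nonempty, truncatedWeight inc (fun γ => w γ z) C

/-- `W_D(z) = log Z(Λ; z) − log Z(Λ ∖ D; z)` (`sum_truncatedWeight_meet_eq`). [folklore] -/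
theorem pieceLog_eq_logZ_sub (w : P → ℂ → ℂ) (Λ D : Finset P) (z : ℂ) :
    pieceLog inc w Λ D z =
      polymerLogZ inc (fun γ => w γ z) Λ - polymerLogZ inc (fun γ => w γ z) (Λ \ D) :=
  sum_truncatedWeight_meet_eq _ Λ D

/-- `exp(−W_D(z))` is the reduced activity `Z(Λ∖D; z)/Z(Λ; z)` of `T4DilationKP` (`pieceRatio_eq_exp` BY NAME).
[cite: KoteckyPreiss1986, (5) p. 492] -/
theorem cexp_neg_pieceLog [Std.Refl inc] [Std.Symm inc] {w : P → ℂ → ℂ} {a : P → ℝ} {Λ : Finset P}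
    {U : Set ℂ} (h : IsKPOn inc w a Λ U) (D : Finset P) {z : ℂ} (hz : z ∈ U) :
    Complex.exp (-pieceLog inc w Λ D z) = pieceRatio inc w Λ D z := by
  unfold pieceLog
  exact (pieceRatio_eq_exp h D hz).symm

/-- **HOLOMORPHY OF THE PIECE LOGARITHM** on `U`. [folklore] -/
theorem differentiableOn_pieceLog [Std.Refl inc] [Std.Symm inc] {w : P → ℂ → ℂ} {a : P → ℝ}
    {Λ : Finset P} {U : Set ℂ} (hw : ∀ γ ∈ Λ, DifferentiableOn ℂ (w γ) U) (h : IsKPOn inc w a Λ U)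
    (D : Finset P) : DifferentiableOn ℂ (pieceLog inc w Λ D) U :=
  ((differentiableOn_logZ hw h Λ (Finset.Subset.refl Λ)).sub
    (differentiableOn_logZ hw h (Λ \ D) Finset.sdiff_subset)).congr fun z _ => pieceLog_eq_logZ_sub w Λ D z

/-- **VOLUME-UNIFORM BOUND ON THE PIECE LOGARITHM**: `‖W_D(z)‖ ≤ Σ_{γ∈D} |w γ z| e^{a γ} ≤ Σ_{γ ∈ D} a γ` for `z ∈ U`,
`D ⊆ Λ` — independent of `Λ` (`norm_polymerLogZ_sub_sdiff_le`, `sum_kpTerm_le_sum`). [cite: KoteckyPreiss1986, Theorem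
p. 492] -/
theorem norm_pieceLog_le [Std.Refl inc] [Std.Symm inc] {w : P → ℂ → ℂ} {a : P → ℝ} {Λ D : Finset P}
    {U : Set ℂ} (h : IsKPOn inc w a Λ U) (hD : D ⊆ Λ) {z : ℂ} (hz : z ∈ U) :
    ‖pieceLog inc w Λ D z‖ ≤ ∑ γ ∈ D, a γ := by
  rw [pieceLog_eq_logZ_sub]
  exact (norm_polymerLogZ_sub_sdiff_le (h z hz) (Finset.Subset.refl Λ) hD).trans
    (sum_kpTerm_le_sum (h z hz) hD)

/-- **Free energy**: `z ↦ log Z(Λ; z)` is holomorphic on `U` with `‖log Z(Λ; z)‖ ≤ Σ_{γ∈Λ} a γ` (EXTENSIVE, as it must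
be; the volume-uniform objects are the piece logarithms). [folklore] -/
theorem logZ_differentiableOn_and_bound [Std.Refl inc] [Std.Symm inc] {w : P → ℂ → ℂ} {a : P → ℝ}
    {Λ : Finset P} {U : Set ℂ} (hw : ∀ γ ∈ Λ, DifferentiableOn ℂ (w γ) U) (h : IsKPOn inc w a Λ U) :
    DifferentiableOn ℂ (fun z => polymerLogZ inc (fun γ => w γ z) Λ) U ∧
      ∀ z ∈ U, ‖polymerLogZ inc (fun γ => w γ z) Λ‖ ≤ ∑ γ ∈ Λ, a γ :=
  ⟨differentiableOn_logZ hw h Λ (Finset.Subset.refl Λ), fun _ hz =>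
    (norm_polymerLogZ_le (h _ hz) (Finset.Subset.refl Λ)).trans (sum_kpTerm_le_sum (h _ hz) (Finset.Subset.refl Λ))⟩

/-! ## §3  The `hlast` shape for the LOGARITHMIC object and the Lipschitz modulus by name -/

/-- **THE `hlast` SHAPE ON THE EXPANSION BRANCH, LOGARITHMIC FORM.**  If the activities are holomorphic on a set `U`
containing all the dilation discs `closedBall s (c s)`, `s ≥ t₀`, and satisfy KP on `Λ` uniformly on `U`, then for every
piece `D ⊆ Λ` the piece logarithm `W_D` — the model of ONE localised term of an effective action — has LITERALLY the shape
of the binder `hlast` of `T4CouplingAnalyticity.stepTransferV_of_analyticOn`: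
`∃ Dm, DifferentiableOn ℂ W Dm ∧ (∀ z ∈ Dm, ‖W z‖ ≤ M₁) ∧ ∀ s ∈ Ici t₀, closedBall s (c s) ⊆ Dm` with the VOLUME-UNIFORM,
ADDITIVE constant `M₁ = Σ_{γ ∈ D} a γ` (compare the multiplicative `e^{Σ_D a}` of `pieceRatio_dilationAnalytic`).  MODEL
statement; asserts nothing about Bałaban's effective actions. [folklore] -/
theorem pieceLog_dilationAnalytic [Std.Refl inc] [Std.Symm inc] {w : P → ℂ → ℂ} {a : P → ℝ}
    {Λ D : Finset P} {U : Set ℂ} {t₀ c : ℝ} (hU : ∀ s ∈ Set.Ici t₀, closedBall (s : ℂ) (c * s) ⊆ U)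
    (hw : ∀ γ ∈ Λ, DifferentiableOn ℂ (w γ) U) (h : IsKPOn inc w a Λ U) (hD : D ⊆ Λ) :
    ∃ Dm : Set ℂ, DifferentiableOn ℂ (pieceLog inc w Λ D) Dm ∧
      (∀ z ∈ Dm, ‖pieceLog inc w Λ D z‖ ≤ ∑ γ ∈ D, a γ) ∧
      ∀ s ∈ Set.Ici t₀, closedBall (s : ℂ) (c * s) ⊆ Dm :=
  ⟨U, differentiableOn_pieceLog hw h D, fun _ hz => norm_pieceLog_le h hD hz, hU⟩

/-- **LIPSCHITZ MODULUS OF THE LOCALISED LOG-TERM IN THE REAL COUPLING** (Cauchy, `Dimock2015.real_param_lipschitz` BY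
NAME): under the hypotheses of `pieceLog_dilationAnalytic` with `0 < t₀`, `0 < c`, for real couplings `s, s′ ≥ t₀`:
`‖W_D(s) − W_D(s′)‖ ≤ 4(Σ_{γ∈D} a γ)/(c t₀)·|s − s′|` — uniformly in the volume `Λ`, ADDITIVE in the piece. [folklore] -/
theorem pieceLog_lipschitz [Std.Refl inc] [Std.Symm inc] {w : P → ℂ → ℂ} {a : P → ℝ} {Λ D : Finset P}
    {U : Set ℂ} {t₀ c : ℝ} (ht₀ : 0 < t₀) (hc0 : 0 < c)
    (hU : ∀ s ∈ Set.Ici t₀, closedBall (s : ℂ) (c * s) ⊆ U) (hw : ∀ γ ∈ Λ, DifferentiableOn ℂ (w γ) U)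
    (h : IsKPOn inc w a Λ U) (hD : D ⊆ Λ) {s s' : ℝ} (hs : t₀ ≤ s) (hs' : t₀ ≤ s') :
    ‖pieceLog inc w Λ D s - pieceLog inc w Λ D s'‖ ≤ 4 * (∑ γ ∈ D, a γ) / (c * t₀) * |s - s'| := by
  have hDab : ∀ u ∈ Icc (min s s') (max s s'), closedBall (u : ℂ) (c * t₀) ⊆ U := by
    intro u hu
    have hut : t₀ ≤ u := (le_min hs hs').trans hu.1
    exact (closedBall_subset_closedBall (mul_le_mul_of_nonneg_left hut hc0.le)).trans (hU u hut)
  exact Literature.MathematicalPhysics.QuantumFieldTheory.Dimock2015.real_param_lipschitz (mul_pos hc0 ht₀)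
    (differentiableOn_pieceLog hw h D) (fun _ hz => norm_pieceLog_le h hD hz) hDab
    ⟨min_le_left _ _, le_max_left _ _⟩ ⟨min_le_right _ _, le_max_right _ _⟩

/-- **All volumes at once**: KP uniformly on `U` in EVERY volume ⇒ every localised log-term of every volume is Lipschitz in
the real coupling with the constant `4(Σ_D a)/(c t₀)`. [folklore] -/
theorem pieceLog_lipschitz_allVolumes [Std.Refl inc] [Std.Symm inc] {w : P → ℂ → ℂ} {a : P → ℝ} {U : Set ℂ}
    {t₀ c : ℝ} (ht₀ : 0 < t₀) (hc0 : 0 < c) (hU : ∀ s ∈ Set.Ici t₀, closedBall (s : ℂ) (c * s) ⊆ U)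
    (hw : ∀ γ, DifferentiableOn ℂ (w γ) U) (h : ∀ Λ : Finset P, IsKPOn inc w a Λ U) :
    ∀ Λ D : Finset P, D ⊆ Λ → ∀ s s' : ℝ, t₀ ≤ s → t₀ ≤ s' →
      ‖pieceLog inc w Λ D s - pieceLog inc w Λ D s'‖ ≤ 4 * (∑ γ ∈ D, a γ) / (c * t₀) * |s - s'| :=
  fun Λ _ hD _ _ hs hs' => pieceLog_lipschitz ht₀ hc0 hU (fun γ _ => hw γ) (h Λ) hD hs hs'

/-! ## §4  Decay in the size of the clusters: the far cluster sum under the weighted condition -/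

/-- **The `d`-weighted Kotecký–Preiss condition at complex coupling, uniformly on `U`** (finite volume `Λ`):
`Σ_{γ' ∈ Λ, γ' ι γ} |w γ' z| e^{a γ' + d γ'} ≤ a γ` for `γ ∈ Λ`, `z ∈ U` — hypothesis (1) of [KP86] with the decay
weight `d`, for the COMPLEX-COUPLING activities: the typed model form of [H-dil-N] on the expansion branch WITH DECAY
(`d = 0` is `IsKPOn`, `IsWKPOn.isKPOn`).  NOT PRINTED for Bałaban's expansion. [cite: KoteckyPreiss1986, (1) p. 492] -/
def IsWKPOn (inc : P → P → Prop) [DecidableRel inc] (w : P → ℂ → ℂ) (a d : P → ℝ) (Λ : Finset P) (U : Set ℂ) :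
    Prop :=
  ∀ z ∈ U, ∀ γ ∈ Λ, ∑ γ' ∈ Λ with inc γ' γ, ‖w γ' z‖ * Real.exp (a γ' + d γ') ≤ a γ

omit [DecidableEq P] in
/-- The weighted condition with `d ≥ 0` implies the unweighted one (`isKPVolume_of_kpd` BY NAME). [cite: KoteckyPreiss1986,
(1) p. 492] -/
theorem IsWKPOn.isKPOn {w : P → ℂ → ℂ} {a d : P → ℝ} {Λ : Finset P} {U : Set ℂ} (h : IsWKPOn inc w a d Λ U)
    (hd : ∀ γ, 0 ≤ d γ) : IsKPOn inc w a Λ U :=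
  fun z hz => isKPVolume_of_kpd hd (h z hz)

/-- **The far cluster sum through `γ`**: clusters `C ⊆ Λ` containing `γ` of `d`-size `Σ_{γ'∈C} d γ' ≥ r`, at coupling `z`.
[cite: KoteckyPreiss1986, (4) p. 492] -/
def farSum (inc : P → P → Prop) [DecidableRel inc] (w : P → ℂ → ℂ) (d : P → ℝ) (Λ : Finset P) (γ : P) (r : ℝ)
    (z : ℂ) : ℂ :=
  ∑ C ∈ Λ.powerset with (γ ∈ C ∧ r ≤ ∑ γ' ∈ C, d γ'), truncatedWeight inc (fun γ' => w γ' z) C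

/-- **DECAY OF THE FAR CLUSTER SUM** at each coupling of `U`: `‖farSum‖ ≤ a γ·e^{−r}` — the tree's FINITE-VOLUME
Kotecký–Preiss estimate (4) (`ClusterExpansionKPBound.touchSum_le_of_kp`, through
`T4ActivityLipschitz.sum_norm_truncatedWeight_le_of_pin` BY NAME; a cluster containing `γ` touches `γ` by reflexivity).
[cite: KoteckyPreiss1986, Theorem p. 492, estimate (4)] -/
theorem norm_farSum_le [Std.Refl inc] [Std.Symm inc] {w : P → ℂ → ℂ} {a d : P → ℝ} (ha : ∀ γ, 0 ≤ a γ)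
    (hd : ∀ γ, 0 ≤ d γ) {Λ : Finset P} {U : Set ℂ} (h : IsWKPOn inc w a d Λ U) {γ : P} (hγ : γ ∈ Λ) (r : ℝ)
    {z : ℂ} (hz : z ∈ U) : ‖farSum inc w d Λ γ r z‖ ≤ a γ * Real.exp (-r) := by
  unfold farSum
  refine (norm_sum_le _ _).trans
    (Literature.MathematicalPhysics.QuantumFieldTheory.Balaban1983to89.T4ActivityLipschitz.sum_norm_truncatedWeight_le_of_pin
      ha hd (h z hz) hγ (fun C hC => Finset.mem_powerset.1 (Finset.mem_filter.1 hC).1)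
      (fun C hC => ⟨γ, (Finset.mem_filter.1 hC).2.1, Std.Refl.refl γ⟩) fun C hC => (Finset.mem_filter.1 hC).2.2)

/-- **Holomorphy of the far cluster sum** on `U` (finite sum of holomorphic Ursell functions). [folklore] -/
theorem differentiableOn_farSum [Std.Refl inc] [Std.Symm inc] {w : P → ℂ → ℂ} {a : P → ℝ} {Λ : Finset P}
    {U : Set ℂ} (hw : ∀ γ ∈ Λ, DifferentiableOn ℂ (w γ) U) (h : IsKPOn inc w a Λ U) (d : P → ℝ) (γ : P)
    (r : ℝ) : DifferentiableOn ℂ (farSum inc w d Λ γ r) U := by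
  unfold farSum
  refine DifferentiableOn.fun_sum fun C hC => ?_
  exact differentiableOn_truncatedWeight hw h (Finset.mem_powerset.1 (Finset.mem_filter.1 hC).1)

/-- **THE `hlast` SHAPE WITH DECAY**: under the weighted condition at every coupling of a set `U ⊇` the dilation discs and
holomorphy of the activities there, the far cluster sum through `γ ∈ Λ` of size `≥ r` is holomorphic on `U` with the bound
`a γ·e^{−r}`, uniformly in the volume — the model of a constant decaying in the size of the localisation domain, the way
`M₁ j = M e^{−A₀ (log t_j)^{p₀}}` of `hlast` is shaped.  The decay is EXACTLY hypothesis (1)-with-`d` at complex coupling;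
nothing here produces it. [cite: KoteckyPreiss1986, Theorem p. 492, estimate (4)] -/
theorem farSum_dilationAnalytic [Std.Refl inc] [Std.Symm inc] {w : P → ℂ → ℂ} {a d : P → ℝ} (ha : ∀ γ, 0 ≤ a γ)
    (hd : ∀ γ, 0 ≤ d γ) {Λ : Finset P} {U : Set ℂ} {t₀ c : ℝ}
    (hU : ∀ s ∈ Set.Ici t₀, closedBall (s : ℂ) (c * s) ⊆ U) (hw : ∀ γ ∈ Λ, DifferentiableOn ℂ (w γ) U)
    (h : IsWKPOn inc w a d Λ U) {γ : P} (hγ : γ ∈ Λ) (r : ℝ) :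
    ∃ Dm : Set ℂ, DifferentiableOn ℂ (farSum inc w d Λ γ r) Dm ∧
      (∀ z ∈ Dm, ‖farSum inc w d Λ γ r z‖ ≤ a γ * Real.exp (-r)) ∧
      ∀ s ∈ Set.Ici t₀, closedBall (s : ℂ) (c * s) ⊆ Dm :=
  ⟨U, differentiableOn_farSum hw (h.isKPOn hd) d γ r, fun _ hz => norm_farSum_le ha hd h hγ r hz, hU⟩

/-! ## §5  Non-vacuity: the one-polymer system of `T4DilationKP` §5 -/

/-- **THE EXAMPLE DISCHARGES §3 BY NAME**: for `0 < t₀`, `0 < c < 1`, `0 ≤ ε ≤ e^{−1}`, the piece logarithm of the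
one-polymer system with activity `ε e^{−z}` — `W(z) = Log (1 + ε e^{−z})` — is Lipschitz in the real coupling on `[t₀, ∞[`
with constant `4/(c t₀)`, by `pieceLog_lipschitz` (hypotheses `isKPOn_expActivity`, `differentiable_expActivity`,
`closedBall_subset_halfPlane` of `T4DilationKP` BY NAME). [folklore] -/
theorem expActivity_pieceLog_lipschitz {ε t₀ c : ℝ} (hε0 : 0 ≤ ε) (hε : ε ≤ Real.exp (-1)) (ht₀ : 0 < t₀)
    (hc0 : 0 < c) (hc : c < 1) {s s' : ℝ} (hs : t₀ ≤ s) (hs' : t₀ ≤ s') :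
    ‖pieceLog topInc (expActivity ε) {()} {()} s - pieceLog topInc (expActivity ε) {()} {()} s'‖
      ≤ 4 * (∑ _γ ∈ ({()} : Finset Unit), (1 : ℝ)) / (c * t₀) * |s - s'| :=
  pieceLog_lipschitz ht₀ hc0 (closedBall_subset_halfPlane ht₀ hc)
    (fun γ _ => (differentiable_expActivity ε γ).differentiableOn) (isKPOn_expActivity hε0 hε _)
    (Finset.Subset.refl _) hs hs'

end Literature.MathematicalPhysics.QuantumFieldTheory.Balaban1983to89.T4DilationKPLog

end
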